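import Summits.QuantumAdvantage.QuantumAdvantage.Theorems.RankDialL4
import Summits.QuantumAdvantage.QuantumAdvantage.Theorems.RankDialL1
import HarnessLib

/-!
# RankDial (L5) — §33–§35 THE COUNTING SKELETON OF A BLOCK LAW, the canonical classification, the inside-cut count (addendum to node «BlockDial»)

TARGET BY NAME (cell decomp-qadv, RESIDUAL MODE): item stmt-QuantumAdvantage-23109
`Summit.QuantumAdvantage.QuantumAdvantage.Theses.OddPrimeWalk.ManyReadersSqrtOdd`, through rung R5 = `AdviceFreeQNC0.WalkHardFLinSel p`.
This file SUPPORTS the item (`--supports`); it does not close it.  Declaration bodies are byte-identical to §33–§35 of the cell node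
«BlockDial» (decomp-qadv lens-1, generation 27, part L; node file RankDialL.lean, rev 3).  §33 `card_win_le_of_labelBias`: on a content set
`V` sharing a classified pass set, label bias `ε` (`#{v ∈ V : blockLabel v = z} ≤ |V|/3^{J+1} + ε` for every label `z`) gives
`#{v ∈ V : WIN} ≤ (2/3)|V| + 2·3^J·ε` (`card_win_eq_card_winLabel` of part L4 + `multiLiveness` of part L3) — the only place the walk game
enters a block law.  §34 the canonical classification `kindOf`/`posOf` of a pass set (inside cuts ranked in increasing order), giving the
dictionary and the skeleton with NO side conditions (`ringWinU_glue3_iff_winLabel_canonical`, `card_win_le_of_labelBias_canonical`).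
§35 `succ_card_insideCuts_mul_le`: an `η`-separated block admits `J` inside live cuts only if `(J + 1)·⌊ℓ/η⌋ ≤ ℓ`.  Imports parts L4 (L3) and L1 (`SepBlock`, `Live`, §35).
-/

set_option linter.dupNamespace false
set_option autoImplicit false

noncomputable section
open Classical

namespace Summit.QuantumAdvantage.QuantumAdvantage.Theorems.RankDial

open Finset
open Summit.QuantumAdvantage.AdviceFreeQNC0
open Literature.Computability.MetaComplexity Literature.Computability.MetaComplexity.Smolensky

/-! ### §33 (part L «BlockDial») THE COUNTING SKELETON OF A BLOCK LAW: label bias `ε` ⟹ `#WIN ≤ (2/3)|V| + 2·3^J·ε` -/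

section BlockLawSkeleton
variable {L ℓ R : ℕ} (c : ℕ) (y : Fin (L + ℓ + R + 1) → (Fin (L + ℓ + R) → Bool) → Bool)
  (a : Fin L → Bool) (b : Fin R → Bool)

/-- `|ℤ₃ × ℤ₃^J| = 3^{J+1}`. -/
theorem card_label_space (J : ℕ) : Fintype.card (ZMod 3 × (Fin J → ZMod 3)) = 3 ^ (J + 1) := by
  simp [Fintype.card_prod, ZMod.card, pow_succ, mul_comm]

/-- At most `2·3^J` labels are winning (`multiLiveness`, unpacked). -/
theorem card_winLabel_le {G : Type*} [Fintype G] {J : ℕ} (kind : G → Option (Fin J)) (k : G → ZMod 3) :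
    (univ.filter fun z : ZMod 3 × (Fin J → ZMod 3) => WinLabel kind k z).card ≤ 2 * 3 ^ J := by
  have h := multiLiveness kind k
  rw [card_label_space] at h
  have h3 : 3 ^ (J + 1) = 3 * 3 ^ J := by rw [pow_succ, mul_comm]
  rw [h3] at h
  omega

/-- **THE COUNTING SKELETON OF EVERY BLOCK LAW.**  Let `V` be a set of contents sharing the pass set `P` (classified by `kind` as in
`ringWinU_glue3_iff_winLabel`).  If every label class in `V` has at most its fair share plus `ε`,
`#{v ∈ V : blockLabel v = z} ≤ |V|/3^{J+1} + ε` for all `z`, then `#{v ∈ V : WIN} ≤ (2/3)·|V| + 2·3^J·ε`.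
Proof: winners = contents with a winning label (`card_win_eq_card_winLabel`), fibre over the `≤ 2·3^J` winning labels (`card_winLabel_le`).
This is the only place the walk game enters a block law: what remains for `BlockJSpan p η` is the label-equidistribution estimate (`ε` small on
outside-fibre ∩ level-set classes of long `η`-separated blocks of small junta-rank), a pure character-sum statement. -/
theorem card_win_le_of_labelBias {J : ℕ} (h : Fin J → ℕ) (P : Finset (Fin (L + ℓ + R + 1)))
    (kind : {g // g ∈ P} → Option (Fin J))
    (hnone : ∀ g, kind g = none → (g.1.val ≤ L ∨ L + ℓ ≤ g.1.val))
    (hsome : ∀ g j, kind g = some j → g.1.val = h j ∧ L < h j ∧ h j < L + ℓ)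
    (V : Finset (Fin ℓ → Bool)) (hV : ∀ v ∈ V, ∀ g, g ∈ P ↔ y g (glue3 a v b) = true) (ε : ℝ)
    (hε : ∀ z : ZMod 3 × (Fin J → ZMod 3),
      ((V.filter fun v => blockLabel L h v = z).card : ℝ) ≤ (V.card : ℝ) / 3 ^ (J + 1) + ε) :
    ((V.filter fun v => ringWinU c y (glue3 a v b) = true).card : ℝ) ≤
      2 / 3 * (V.card : ℝ) + 2 * 3 ^ J * ε := by
  set k : {g // g ∈ P} → ZMod 3 := fun g => deadVal ℓ c a b g.1.val with hk
  set W := (univ.filter fun z : ZMod 3 × (Fin J → ZMod 3) => WinLabel kind k z) with hW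
  set S := V.filter fun v => WinLabel kind k (blockLabel L h v) with hS
  set X : ℝ := (V.card : ℝ) / 3 ^ (J + 1) + ε with hX
  have hX0 : 0 ≤ X := le_trans (Nat.cast_nonneg _) (hε 0)
  -- winners = contents with a winning label
  have h1 : (V.filter fun v => ringWinU c y (glue3 a v b) = true).card = S.card :=
    card_win_eq_card_winLabel c y a b h P kind hnone hsome V hV
  -- fibre over the winning labels
  have h2 : S.card = ∑ z ∈ W, (S.filter fun v => blockLabel L h v = z).card := by
    apply Finset.card_eq_sum_card_fiberwise
    intro v hv
    have hv' : v ∈ S := Finset.mem_coe.mp hv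
    rw [Finset.mem_coe, hW, Finset.mem_filter]
    exact ⟨Finset.mem_univ _, (Finset.mem_filter.mp hv').2⟩
  have h3 : ∀ z, ((S.filter fun v => blockLabel L h v = z).card : ℝ) ≤ X := by
    intro z
    refine le_trans ?_ (hε z)
    exact_mod_cast Finset.card_le_card (Finset.filter_subset_filter _ (Finset.filter_subset _ V))
  have h4 : (W.card : ℝ) ≤ 2 * 3 ^ J := by exact_mod_cast card_winLabel_le kind k
  have h5 : (S.card : ℝ) ≤ (W.card : ℝ) * X := by
    rw [h2]
    push_cast
    calc ∑ z ∈ W, ((S.filter fun v => blockLabel L h v = z).card : ℝ) ≤ ∑ z ∈ W, X := Finset.sum_le_sum fun z _ => h3 z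
      _ = (W.card : ℝ) * X := by rw [Finset.sum_const, nsmul_eq_mul]
  have h6 : (W.card : ℝ) * X ≤ 2 * 3 ^ J * X := mul_le_mul_of_nonneg_right h4 hX0
  have h7 : (2 : ℝ) * 3 ^ J * X = 2 / 3 * (V.card : ℝ) + 2 * 3 ^ J * ε := by
    rw [hX, pow_succ]
    field_simp
  rw [h1]
  linarith [h5, h6, h7]

end BlockLawSkeleton

/-! ### §34 (part L «BlockDial») THE CANONICAL CLASSIFICATION: no side conditions (`kindOf`, `posOf`) -/

section Canonical
variable {L ℓ R : ℕ} (c : ℕ) (y : Fin (L + ℓ + R + 1) → (Fin (L + ℓ + R) → Bool) → Bool)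
  (a : Fin L → Bool) (b : Fin R → Bool)

/-- The passing cuts STRICTLY INSIDE the block: members of `P` at positions `L < g < L + ℓ`. -/
def insideCuts (L ℓ : ℕ) {n : ℕ} (P : Finset (Fin (n + 1))) : Finset (Fin (n + 1)) :=
  P.filter fun g => L < g.val ∧ g.val < L + ℓ

/-- The canonical inside positions: the inside passing cuts in increasing order. -/
def posOf (L ℓ : ℕ) {n : ℕ} (P : Finset (Fin (n + 1))) (j : Fin (insideCuts L ℓ P).card) : ℕ :=
  ((insideCuts L ℓ P).orderEmbOfFin rfl j).val

/-- The canonical classification of the passing cuts: an inside cut ↦ its rank among the inside passing cuts, any other cut ↦ `none`. -/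
def kindOf (L ℓ : ℕ) {n : ℕ} (P : Finset (Fin (n + 1))) (g : {g // g ∈ P}) : Option (Fin (insideCuts L ℓ P).card) :=
  if hg : g.1 ∈ insideCuts L ℓ P then some (((insideCuts L ℓ P).orderIsoOfFin rfl).symm ⟨g.1, hg⟩) else none

/-- `kindOf = none` ⟹ the cut is outside the block (or on its boundary). -/
theorem kindOf_none {n : ℕ} (P : Finset (Fin (n + 1))) (g : {g // g ∈ P}) (h : kindOf L ℓ P g = none) :
    g.1.val ≤ L ∨ L + ℓ ≤ g.1.val := by
  unfold kindOf at h
  by_cases hg : g.1 ∈ insideCuts L ℓ P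
  · rw [dif_pos hg] at h
    exact absurd h (Option.some_ne_none _)
  · have h' : ¬ (L < g.1.val ∧ g.1.val < L + ℓ) := fun h' => hg (Finset.mem_filter.mpr ⟨g.2, h'⟩)
    omega

/-- `kindOf = some j` ⟹ the cut sits at the `j`-th inside position, strictly inside the block. -/
theorem kindOf_some {n : ℕ} (P : Finset (Fin (n + 1))) (g : {g // g ∈ P}) (j : Fin (insideCuts L ℓ P).card)
    (h : kindOf L ℓ P g = some j) : g.1.val = posOf L ℓ P j ∧ L < posOf L ℓ P j ∧ posOf L ℓ P j < L + ℓ := by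
  unfold kindOf at h
  by_cases hg : g.1 ∈ insideCuts L ℓ P
  · rw [dif_pos hg] at h
    have hj : ((insideCuts L ℓ P).orderIsoOfFin rfl).symm ⟨g.1, hg⟩ = j := Option.some_injective _ h
    have hgj : ((insideCuts L ℓ P).orderEmbOfFin rfl j) = g.1 := by
      rw [← Finset.coe_orderIsoOfFin_apply, ← hj, OrderIso.apply_symm_apply]
    have hmem := (Finset.mem_filter.mp (Finset.orderEmbOfFin_mem (insideCuts L ℓ P) rfl j)).2
    unfold posOf
    exact ⟨by rw [hgj], hmem.1, hmem.2⟩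
  · rw [dif_neg hg] at h
    exact absurd h.symm (Option.some_ne_none _)

/-- **THE DICTIONARY WITH NO SIDE CONDITIONS.**  For every table `y`, charge `c`, outside bits `a, b`, content `v` and the pass set `P`
at `u = a ++ v ++ b`: `ringWinU c y u = true ↔ WinLabel (kindOf L ℓ P) deadVal (blockLabel L (posOf L ℓ P) v)`. -/
theorem ringWinU_glue3_iff_winLabel_canonical (v : Fin ℓ → Bool) (P : Finset (Fin (L + ℓ + R + 1)))
    (hP : ∀ g, g ∈ P ↔ y g (glue3 a v b) = true) :
    ringWinU c y (glue3 a v b) = true ↔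
      WinLabel (kindOf L ℓ P) (fun g => deadVal ℓ c a b g.1.val) (blockLabel L (posOf L ℓ P) v) :=
  ringWinU_glue3_iff_winLabel c y a b (posOf L ℓ P) v P hP (kindOf L ℓ P) (fun g hg => kindOf_none P g hg)
    (fun g j hg => kindOf_some P g j hg)

/-- **The counting skeleton with the canonical classification**: for a content set `V` sharing the pass set `P`, with `J` inside passing
cuts, label bias `ε` gives `#{v ∈ V : WIN} ≤ (2/3)|V| + 2·3^J·ε`. -/
theorem card_win_le_of_labelBias_canonical (P : Finset (Fin (L + ℓ + R + 1))) (V : Finset (Fin ℓ → Bool))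
    (hV : ∀ v ∈ V, ∀ g, g ∈ P ↔ y g (glue3 a v b) = true) (ε : ℝ)
    (hε : ∀ z : ZMod 3 × (Fin (insideCuts L ℓ P).card → ZMod 3),
      ((V.filter fun v => blockLabel L (posOf L ℓ P) v = z).card : ℝ) ≤ (V.card : ℝ) / 3 ^ ((insideCuts L ℓ P).card + 1) + ε) :
    ((V.filter fun v => ringWinU c y (glue3 a v b) = true).card : ℝ) ≤
      2 / 3 * (V.card : ℝ) + 2 * 3 ^ (insideCuts L ℓ P).card * ε :=
  card_win_le_of_labelBias c y a b (posOf L ℓ P) P (kindOf L ℓ P) (fun g hg => kindOf_none P g hg)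
    (fun g j hg => kindOf_some P g j hg) V hV ε hε

/-! ### §35 (part L «BlockDial») HOW MANY INSIDE CUTS AN `η`-SEPARATED BLOCK ADMITS: `(J + 1)·⌊ℓ/η⌋ ≤ ℓ` -/

/-- **Counting the inside cuts of an `η`-separated block.**  If the block `[L, L+ℓ)` is `η`-separated and every cut of `P` is live (e.g.
`P` is a pass set), then the `J` inside cuts of `P` satisfy `(J + 1)·⌊ℓ/η⌋ ≤ ℓ` (they sit at `L + ⌊ℓ/η⌋ ≤ p₀`, `p_j + ⌊ℓ/η⌋ ≤ p_{j+1}`,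
`p_{J−1} + ⌊ℓ/η⌋ ≤ L + ℓ`).  Hence `J ≤ ℓ/⌊ℓ/η⌋ − 1`, which is `< η` as soon as `ℓ > η² + η` (ERRATUM to the parenthetical "fewer than
`η` inside live cuts" in the docstring of `SepBlock`: true for long blocks, `ℓ > η² + η`, not for all `ℓ`). -/
theorem succ_card_insideCuts_mul_le {n : ℕ} (y' : Fin (n + 1) → (Fin n → Bool) → Bool) {a' m η : ℕ}
    (hsep : SepBlock y' a' m η) (P : Finset (Fin (n + 1))) (hlive : ∀ g ∈ P, Live y' g) :
    ((insideCuts a' m P).card + 1) * (m / η) ≤ m := by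
  set I := insideCuts a' m P with hI
  set J := I.card with hJ
  set e := I.orderEmbOfFin rfl with he
  have hmem : ∀ j : Fin J, a' < (e j).val ∧ (e j).val < a' + m ∧ Live y' (e j) := by
    intro j
    have h := Finset.orderEmbOfFin_mem I rfl j
    have h' := Finset.mem_filter.mp h
    exact ⟨h'.2.1, h'.2.2, hlive _ h'.1⟩
  -- positions grow by at least `m/η` per step
  have hstep : ∀ j : Fin J, a' + (j.val + 1) * (m / η) ≤ (e j).val := by
    intro j
    induction' hjv : j.val with k ih generalizing j
    · have h := (hsep.1 (e j) (hmem j).1 (hmem j).2.1 (hmem j).2.2).1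
      simpa using h
    · have hk : k < J := by omega
      set j' : Fin J := ⟨k, hk⟩ with hj'def
      have ih' := ih j' rfl
      have hlt : (e j').val < (e j).val := by
        have hjj : j' < j := by
          rw [Fin.lt_def]
          show k < j.val
          omega
        exact e.strictMono hjj
      have h2 := hsep.2 (e j') (e j) (hmem j').1 (hmem j).2.1 hlt (hmem j').2.2 (hmem j).2.2
      have h3 : a' + (k + 1 + 1) * (m / η) = a' + (k + 1) * (m / η) + m / η := by ring
      omega
  by_cases hJ0 : J = 0
  · rw [hJ0]; simpa using Nat.div_le_self m η
  · set jl : Fin J := ⟨J - 1, by omega⟩ with hjl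
    have h2 := (hsep.1 (e jl) (hmem jl).1 (hmem jl).2.1 (hmem jl).2.2).2
    have h4 : a' + J * (m / η) ≤ (e jl).val := by
      have h1 := hstep jl
      have hv : jl.val + 1 = J := by show J - 1 + 1 = J; omega
      rw [hv] at h1
      exact h1
    have h5 : (J + 1) * (m / η) = J * (m / η) + m / η := by ring
    omega

/-- For a pass set: every passing cut is live, so `(J + 1)·⌊ℓ/η⌋ ≤ ℓ` for the inside passing cuts of an `η`-separated block. -/
theorem succ_card_insideCuts_mul_le_of_pass (v : Fin ℓ → Bool) (P : Finset (Fin (L + ℓ + R + 1)))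
    (hP : ∀ g, g ∈ P ↔ y g (glue3 a v b) = true) {η : ℕ} (hsep : SepBlock y L ℓ η) :
    ((insideCuts L ℓ P).card + 1) * (ℓ / η) ≤ ℓ :=
  succ_card_insideCuts_mul_le y hsep P fun g hg => ⟨glue3 a v b, (hP g).mp hg⟩

end Canonical

end Summit.QuantumAdvantage.QuantumAdvantage.Theorems.RankDial
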